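import Summits.KontsevichZagierPeriods.KontsevichZagierPeriods.Theses.SymplecticScissors
import Literature.NumberTheory.Transcendental.KZCalculusProofs
import Literature.NumberTheory.Transcendental.KZSubcalculusInvariants

/-!
# `PlanarK0Injective` (stmt-KontsevichZagierPeriods-9847) — negative side, kit

Refuter (`cdisprove`, cycle 1) by-products for the crux `PlanarK0Injective` of route `SymplecticScissors`
(two planar ℚ-semialgebraic sets of equal finite area differ, in the free group on planar sets, by
instances of rules (1a) and (2) only). Nothing here refutes the crux. Contents:

* §0 kit — `planarGens`/`planarGroup` (verbatim the crux's subgroup; `planarK0Injective_iff` is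
  `Iff.rfl`), soundness `eval_eq_zero_of_mem_planarGroup` (from `KZ.relations_le_ker_eval_holds`),
  rational open/closed boxes as planar sets (`boxRep`, `closedBoxRep`, their areas), the free-group
  pinning lemma `eq_of_of_sub_of_eq` (`of a − of b = of c − of d`, `a ≠ b` ⇒ `a = c ∧ b = d`: a
  single-move membership is an instance FROM `r` ONTO `r'`), the two unit squares and
  `not_isCompact_openUnitSquare`.
* §1 junk immunity — null planar sets are `0` in `planarGroup` (`N = N ∪ N` in rule 1a); planar sets
  with equal domains are congruent by the identity move (off-domain integrand values are invisible).
  So every invariant a disprover may try must factor through the Lebesgue class of the domain.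

Consumers: `Negative/LoadBearing.lean` (load-bearing hypotheses, tightness, calibration).
[Kontsevich–Zagier 2001, §1.2; Cresson–Viu-Sos 2022, Problem 2.1]
-/

noncomputable section

open MeasureTheory Set MvPolynomial
open Literature.NumberTheory.Transcendental Literature.ModelTheory.ExponentialFields

namespace Summit.KontsevichZagierPeriods.SymplecticScissors.PlanarK0InjectiveNegative

open Summit.KontsevichZagierPeriods.KontsevichZagierPeriods.Theses.SymplecticScissors (PlanarK0Injective)

/-! ## §0 Kit: the planar set-chain group, rational boxes, free-group pinning -/

/-- The generators of the planar sector: `[s]` for `s : IntegralRep 2` with integrand `1` on its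
domain ("planar sets"); verbatim the inner set of the crux. [folklore] -/
def planarGens : Set KZ.FormalRep :=
  {x | ∃ s : KZ.IntegralRep 2, (∀ p ∈ s.domain, s.integrand p = 1) ∧ x = KZ.of s}

/-- The planar set-chain group of the crux: the subgroup generated by the instances of rules (1a)
and (2) that are ℤ-combinations of planar sets; verbatim the subgroup of the crux. [folklore] -/
def planarGroup : AddSubgroup KZ.FormalRep :=
  AddSubgroup.closure ((KZ.domainAddRel ∪ KZ.changeOfVariablesRel) ∩
    (AddSubgroup.closure planarGens : Set KZ.FormalRep))

/-- The crux, restated through `planarGroup` (definitional). [folklore] -/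
theorem planarK0Injective_iff :
    PlanarK0Injective ↔ ∀ r r' : KZ.IntegralRep 2, (∀ p ∈ r.domain, r.integrand p = 1) →
      (∀ p ∈ r'.domain, r'.integrand p = 1) → r.value = r'.value →
      KZ.of r - KZ.of r' ∈ planarGroup := Iff.rfl

/-- The planar set-chain group lies in `KZ.relations` (this is the support `GroupToAreas`). [folklore] -/
theorem planarGroup_le_relations : planarGroup ≤ KZ.relations :=
  (AddSubgroup.closure_le _).mpr fun _ hc => hc.1.elim (fun h => KZ.domainAddRel_subset_relations h)
    (fun h => KZ.changeOfVariablesRel_subset_relations h)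

/-- Soundness of the planar set-chain group: its elements evaluate to `0`
(`KZ.relations_le_ker_eval_holds`). [folklore] -/
theorem eval_eq_zero_of_mem_planarGroup {c : KZ.FormalRep} (hc : c ∈ planarGroup) : KZ.eval c = 0 := by
  have h : KZ.relations ≤ KZ.eval.ker := KZ.relations_le_ker_eval_holds
  exact AddMonoidHom.mem_ker.mp (h (planarGroup_le_relations hc))

/-- Open coordinate box `∏ᵢ (lᵢ, uᵢ)` in the plane. [folklore] -/
def box (l u : Fin 2 → ℝ) : Set (Fin 2 → ℝ) := Set.pi univ fun i => Ioo (l i) (u i)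

/-- Membership in a box. [folklore] -/
theorem mem_box {l u : Fin 2 → ℝ} {p : Fin 2 → ℝ} : p ∈ box l u ↔ ∀ i, l i < p i ∧ p i < u i := by
  simp [box]

/-- Coordinate slabs `{lo < pᵢ < hi}` with rational ends are ℚ-semialgebraic. [folklore] -/
theorem isSemialgebraic_coord_Ioo (i : Fin 2) (l u : ℚ) :
    IsSemialgebraic ℚ {p : Fin 2 → ℝ | p i ∈ Ioo (l : ℝ) u} := by
  have h := (isSemialgebraic_setOf_eval_lt (k := ℚ) (R := ℝ) (ι := Fin 2) (C l) (X i)).inter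
    (isSemialgebraic_setOf_eval_lt (k := ℚ) (R := ℝ) (ι := Fin 2) (X i) (C u))
  have hEq : {p : Fin 2 → ℝ | p i ∈ Ioo (l : ℝ) u} =
      {x : Fin 2 → ℝ | aeval x (C l : MvPolynomial (Fin 2) ℚ) < aeval x (X i : MvPolynomial (Fin 2) ℚ)} ∩
      {x : Fin 2 → ℝ | aeval x (X i : MvPolynomial (Fin 2) ℚ) < aeval x (C u : MvPolynomial (Fin 2) ℚ)} := by
    ext p; simp
  rw [hEq]; exact h

/-- Closed coordinate slabs `{lo ≤ pᵢ ≤ hi}` with rational ends are ℚ-semialgebraic. [folklore] -/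
theorem isSemialgebraic_coord_Icc (i : Fin 2) (l u : ℚ) :
    IsSemialgebraic ℚ {p : Fin 2 → ℝ | p i ∈ Icc (l : ℝ) u} := by
  have h := (isSemialgebraic_setOf_eval_le (k := ℚ) (R := ℝ) (ι := Fin 2) (C l) (X i)).inter
    (isSemialgebraic_setOf_eval_le (k := ℚ) (R := ℝ) (ι := Fin 2) (X i) (C u))
  have hEq : {p : Fin 2 → ℝ | p i ∈ Icc (l : ℝ) u} =
      {x : Fin 2 → ℝ | aeval x (C l : MvPolynomial (Fin 2) ℚ) ≤ aeval x (X i : MvPolynomial (Fin 2) ℚ)} ∩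
      {x : Fin 2 → ℝ | aeval x (X i : MvPolynomial (Fin 2) ℚ) ≤ aeval x (C u : MvPolynomial (Fin 2) ℚ)} := by
    ext p; simp
  rw [hEq]; exact h

/-- A box is the intersection of its coordinate slabs. [folklore] -/
theorem box_eq_iInter (l u : Fin 2 → ℝ) :
    box l u = ⋂ i ∈ (Finset.univ : Finset (Fin 2)), {p : Fin 2 → ℝ | p i ∈ Ioo (l i) (u i)} := by
  ext p; simp [box]

/-- Open boxes with rational corners are ℚ-semialgebraic. [folklore] -/
theorem isSemialgebraic_box (l u : Fin 2 → ℚ) :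
    IsSemialgebraic ℚ (box (fun i => (l i : ℝ)) (fun i => (u i : ℝ))) := by
  rw [box_eq_iInter]
  exact IsSemialgebraic.biInter _ _ fun i _ => isSemialgebraic_coord_Ioo i (l i) (u i)

/-- A closed box is the intersection of its closed coordinate slabs. [folklore] -/
theorem Icc_eq_iInter (l u : Fin 2 → ℝ) :
    Icc l u = ⋂ i ∈ (Finset.univ : Finset (Fin 2)), {p : Fin 2 → ℝ | p i ∈ Icc (l i) (u i)} := by
  ext p; simp [Pi.le_def, forall_and]

/-- Closed boxes with rational corners are ℚ-semialgebraic. [folklore] -/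
theorem isSemialgebraic_Icc (l u : Fin 2 → ℚ) :
    IsSemialgebraic ℚ (Icc (fun i => (l i : ℝ)) (fun i => (u i : ℝ))) := by
  rw [Icc_eq_iInter]
  exact IsSemialgebraic.biInter _ _ fun i _ => isSemialgebraic_coord_Icc i (l i) (u i)

/-- The constant function `1` is ℚ-semialgebraic on every ℚ-semialgebraic set. [folklore] -/
theorem isSemialgebraicFunOn_one {s : Set (Fin 2 → ℝ)} (hs : IsSemialgebraic ℚ s) :
    IsSemialgebraicFunOn ℚ s (fun _ => (1 : ℝ)) :=
  (isSemialgebraicFunOn_natCast hs 1).congr fun _ _ => by simp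

/-- An open box lies in the closed box. [folklore] -/
theorem box_subset_Icc (l u : Fin 2 → ℝ) : box l u ⊆ Icc l u :=
  (Set.pi_univ_Ioo_subset l u).trans Ioo_subset_Icc_self

/-- Boxes have finite area. [folklore] -/
theorem volume_box_ne_top (l u : Fin 2 → ℝ) : volume (box l u) ≠ ⊤ :=
  ((measure_mono (box_subset_Icc l u)).trans_lt (isCompact_Icc.measure_lt_top)).ne

/-- The open rational box `∏ (lᵢ, uᵢ)` as a planar set (integrand `1`). [folklore] -/
def boxRep (l u : Fin 2 → ℚ) : KZ.IntegralRep 2 where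
  domain := box (fun i => (l i : ℝ)) (fun i => (u i : ℝ))
  integrand := fun _ => 1
  isSemialgebraic_domain := isSemialgebraic_box l u
  isSemialgebraicFunOn_integrand := isSemialgebraicFunOn_one (isSemialgebraic_box l u)
  integrableOn := integrableOn_const (volume_box_ne_top _ _)

/-- The closed rational box `∏ [lᵢ, uᵢ]` as a planar set (integrand `1`). [folklore] -/
def closedBoxRep (l u : Fin 2 → ℚ) : KZ.IntegralRep 2 where
  domain := Icc (fun i => (l i : ℝ)) (fun i => (u i : ℝ))
  integrand := fun _ => 1
  isSemialgebraic_domain := isSemialgebraic_Icc l u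
  isSemialgebraicFunOn_integrand := isSemialgebraicFunOn_one (isSemialgebraic_Icc l u)
  integrableOn := integrableOn_const (isCompact_Icc.measure_lt_top).ne

/-- Unfolding. [folklore] -/
@[simp] theorem boxRep_domain (l u : Fin 2 → ℚ) :
    (boxRep l u).domain = box (fun i => (l i : ℝ)) (fun i => (u i : ℝ)) := rfl
/-- Unfolding. [folklore] -/
@[simp] theorem boxRep_integrand (l u : Fin 2 → ℚ) : (boxRep l u).integrand = fun _ => 1 := rfl
/-- Unfolding. [folklore] -/
@[simp] theorem closedBoxRep_domain (l u : Fin 2 → ℚ) :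
    (closedBoxRep l u).domain = Icc (fun i => (l i : ℝ)) (fun i => (u i : ℝ)) := rfl
/-- Unfolding. [folklore] -/
@[simp] theorem closedBoxRep_integrand (l u : Fin 2 → ℚ) : (closedBoxRep l u).integrand = fun _ => 1 := rfl

/-- The area of an open rational box. [folklore] -/
theorem value_boxRep {l u : Fin 2 → ℚ} (h : ∀ i, l i ≤ u i) :
    (boxRep l u).value = ((u 0 : ℝ) - l 0) * ((u 1 : ℝ) - l 1) := by
  have hle : (fun i => (l i : ℝ)) ≤ fun i => (u i : ℝ) :=
    fun i => show ((l i : ℚ) : ℝ) ≤ ((u i : ℚ) : ℝ) from by exact_mod_cast h i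
  simp only [KZ.IntegralRep.value, boxRep_domain, boxRep_integrand, setIntegral_const, smul_eq_mul,
    mul_one, Measure.real, box]
  rw [Real.volume_pi_Ioo_toReal hle]
  simp [Fin.prod_univ_two]

/-- The area of a closed rational box. [folklore] -/
theorem value_closedBoxRep {l u : Fin 2 → ℚ} (h : ∀ i, l i ≤ u i) :
    (closedBoxRep l u).value = ((u 0 : ℝ) - l 0) * ((u 1 : ℝ) - l 1) := by
  have hle : (fun i => (l i : ℝ)) ≤ fun i => (u i : ℝ) :=
    fun i => show ((l i : ℚ) : ℝ) ≤ ((u i : ℚ) : ℝ) from by exact_mod_cast h i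
  simp only [KZ.IntegralRep.value, closedBoxRep_domain, closedBoxRep_integrand, setIntegral_const,
    smul_eq_mul, mul_one, Measure.real]
  rw [Real.volume_Icc_pi_toReal hle]
  simp [Fin.prod_univ_two]

/-- FREE-GROUP PINNING: in a free abelian group, `of a − of b = of c − of d` with `a ≠ b` forces
`a = c` and `b = d` (evaluate the counting homomorphisms at `a` and at `b`). This is what pins a
single-move membership `[r] − [r'] ∈ changeOfVariablesRel` to an instance FROM `r` ONTO `r'`. [folklore] -/
theorem eq_of_of_sub_of_eq {X : Type*} {a b c d : X} (hab : a ≠ b)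
    (h : FreeAbelianGroup.of a - FreeAbelianGroup.of b =
      FreeAbelianGroup.of c - FreeAbelianGroup.of d) : a = c ∧ b = d := by
  classical
  have key : ∀ x : X, ((if a = x then (1:ℤ) else 0) - (if b = x then 1 else 0)) =
      ((if c = x then 1 else 0) - (if d = x then 1 else 0)) := fun x => by
    simpa only [map_sub, FreeAbelianGroup.lift_apply_of] using
      congrArg (FreeAbelianGroup.lift fun y => if y = x then (1:ℤ) else 0) h
  have ha := key a
  have hb := key b
  rw [if_pos rfl, if_neg (Ne.symm hab)] at ha
  rw [if_pos rfl, if_neg hab] at hb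
  refine ⟨?_, ?_⟩
  · by_contra hca
    rw [if_neg (show ¬ c = a from fun h => hca h.symm)] at ha
    by_cases hda : d = a
    · rw [if_pos hda] at ha; omega
    · rw [if_neg hda] at ha; omega
  · by_contra hdb
    rw [if_neg (show ¬ d = b from fun h => hdb h.symm)] at hb
    by_cases hcb : c = b
    · rw [if_pos hcb] at hb; omega
    · rw [if_neg hcb] at hb; omega


/-! ### The two unit squares -/

/-- The open unit square `(0,1)²` as a planar set. [folklore] -/
abbrev openUnitSquare : KZ.IntegralRep 2 := boxRep ![0, 0] ![1, 1]

/-- The closed unit square `[0,1]²` as a planar set. [folklore] -/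
abbrev closedUnitSquare : KZ.IntegralRep 2 := closedBoxRep ![0, 0] ![1, 1]

/-- Membership in the open unit square. [folklore] -/
theorem mem_openUnitSquare {p : Fin 2 → ℝ} :
    p ∈ openUnitSquare.domain ↔ (0 < p 0 ∧ p 0 < 1) ∧ (0 < p 1 ∧ p 1 < 1) := by
  simp [mem_box, Fin.forall_fin_two]

/-- Membership in the closed unit square. [folklore] -/
theorem mem_closedUnitSquare {p : Fin 2 → ℝ} :
    p ∈ closedUnitSquare.domain ↔ (0 ≤ p 0 ∧ 0 ≤ p 1) ∧ (p 0 ≤ 1 ∧ p 1 ≤ 1) := by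
  simp [Pi.le_def, Fin.forall_fin_two]

/-- The open unit square has area `1`. [folklore] -/
theorem value_openUnitSquare : openUnitSquare.value = 1 := by
  rw [value_boxRep (fun i => by fin_cases i <;> simp)]; simp

/-- The closed unit square has area `1`. [folklore] -/
theorem value_closedUnitSquare : closedUnitSquare.value = 1 := by
  rw [value_closedBoxRep (fun i => by fin_cases i <;> simp)]; simp

/-- The origin lies in the closed unit square. [folklore] -/
theorem zero_mem_closedUnitSquare : (0 : Fin 2 → ℝ) ∈ closedUnitSquare.domain := by
  rw [mem_closedUnitSquare]; norm_num

/-- The origin does not lie in the open unit square. [folklore] -/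
theorem zero_not_mem_openUnitSquare : (0 : Fin 2 → ℝ) ∉ openUnitSquare.domain := by
  rw [mem_openUnitSquare]; norm_num

/-- The two unit squares are different representations. [folklore] -/
theorem openUnitSquare_ne_closedUnitSquare : openUnitSquare ≠ closedUnitSquare := fun h =>
  zero_not_mem_openUnitSquare (h ▸ zero_mem_closedUnitSquare)

/-- The closed unit square is compact. [folklore] -/
theorem isCompact_closedUnitSquare : IsCompact closedUnitSquare.domain := isCompact_Icc

/-- The open unit square is not compact (the first coordinate has no minimum on it). [folklore] -/
theorem not_isCompact_openUnitSquare : ¬ IsCompact openUnitSquare.domain := by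
  intro hK
  have hne : openUnitSquare.domain.Nonempty :=
    ⟨fun _ => 1/2, by rw [mem_openUnitSquare]; norm_num⟩
  obtain ⟨p, hp, hmin⟩ := hK.exists_isMinOn hne (continuous_apply 0).continuousOn
  rw [mem_openUnitSquare] at hp
  set q : Fin 2 → ℝ := Function.update p 0 (p 0 / 2) with hq_def
  have hq : q ∈ openUnitSquare.domain := by
    rw [mem_openUnitSquare]
    simp only [hq_def, Function.update_self, Function.update_of_ne (show (1 : Fin 2) ≠ 0 by decide)]
    refine ⟨⟨by linarith [hp.1.1], by linarith [hp.1.2]⟩, hp.2⟩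
  have hle := (isMinOn_iff.mp hmin) q hq
  simp only [hq_def, Function.update_self] at hle
  linarith [hp.1.1]

/-! ## §1 Positive bookkeeping (formal-junk immunity of the planar set-chain group)

These two lemmas record that the encoding offers a disprover NO foothold through junk: a planar
set of measure zero is `0` in the group, and two planar sets with the same domain (integrands both
`1` on it, arbitrary off it) are congruent by the identity move. -/

/-- A null planar set is trivial in the planar set-chain group: `[N] − [N] − [N] ∈ domainAddRel`
(`N = N ∪ N`, overlap `N` null), hence `[N] ∈ planarGroup`. [folklore] -/
theorem of_mem_planarGroup_of_volume_eq_zero (s : KZ.IntegralRep 2)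
    (hs : ∀ p ∈ s.domain, s.integrand p = 1) (h0 : volume s.domain = 0) :
    KZ.of s ∈ planarGroup := by
  have hgen : KZ.of s ∈ AddSubgroup.closure planarGens := AddSubgroup.subset_closure ⟨s, hs, rfl⟩
  have h1a : KZ.of s - KZ.of s - KZ.of s ∈ KZ.domainAddRel :=
    ⟨2, s, s, s, (union_self _).symm, by simpa using h0, fun _ _ => rfl, fun _ _ => rfl, rfl⟩
  have hneg : -KZ.of s ∈ planarGroup := by
    refine AddSubgroup.subset_closure ⟨Or.inl ?_, ?_⟩
    · simpa using h1a
    · simpa using (AddSubgroup.closure planarGens).neg_mem hgen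
  simpa using planarGroup.neg_mem hneg

/-- Two planar sets with the same domain are congruent by ONE identity move (the integrands agree
with `1` on the domain only; their off-domain values are invisible to the calculus). [folklore] -/
theorem of_sub_of_mem_planarGroup_of_domain_eq (r r' : KZ.IntegralRep 2)
    (hr : ∀ p ∈ r.domain, r.integrand p = 1) (hr' : ∀ p ∈ r'.domain, r'.integrand p = 1)
    (h : r.domain = r'.domain) : KZ.of r - KZ.of r' ∈ planarGroup := by
  refine AddSubgroup.subset_closure ⟨Or.inr ?_, ?_⟩
  · refine ⟨2, r, r', id, fun _ => ContinuousLinearMap.id ℝ (Fin 2 → ℝ),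
      isSemialgebraicMapOn_id r.isSemialgebraic_domain, fun x _ => hasFDerivWithinAt_id x _,
      injOn_id _, by simp [h], fun x hx => ?_, rfl⟩
    simp [hr x hx, hr' x (h ▸ hx), ContinuousLinearMap.det]
  · exact (AddSubgroup.closure planarGens).sub_mem (AddSubgroup.subset_closure ⟨r, hr, rfl⟩)
      (AddSubgroup.subset_closure ⟨r', hr', rfl⟩)

end Summit.KontsevichZagierPeriods.SymplecticScissors.PlanarK0InjectiveNegative
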